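import Literature.Computability.Complexity.MCSPHardness
import Literature.Computability.MetaComplexity.CMMSA
import Literature.Computability.MetaComplexity.PromiseRandReductions
import HarnessLib

/-!
# P vs NP family: NP-hardness of `MCSP*` under randomized reductions (proofs / decomposition)

Sibling proof file of `MCSPHardness.lean` (D-0014: named facts `def X : Prop` are discharged as
`theorem X_holds : X`). Target: `Literature.Computability.Complexity.isRandNPHard_MCSPStar` (`IsRandNPHard MCSPStar`;
Hirahara, FOCS 2022, Thm. 1.2, proved there as Thm. 8.5 of the full version).

## Proof architecture (Hirahara 2022, proof of Thm. 8.5, ECCC TR22-119 pp. 30–31)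

"Let `L` be an arbitrary language in NP. Combining NP-hardness of CMMSA (Theorem 5.2) for the
parameter `Δ(n) := (log n)^{1/2}` with the reduction of Lemma 8.3, we obtain a reduction `R`
from `L ∈ NP` …; the output of the reduction to `MCSP*` is `(f, 1^{s_P})`, `s_P := O(s/log s)`."
The proof is the composite of three results, two of which are deep and are vendored as named
facts, and one of which (the composition) is proved in
`Literature/Computability/MetaComplexity/PromiseRandReductions.lean`:

1. `Hirahara2022_thm52_sqrtLog` (`CMMSA.lean`; Hirahara 2022, Thm. 5.2 at
   `Δ(n) = (log n)^{1/2}`, from the sliding-scale PCP of Dinur–Fischer–Kindler–Raz–Safra /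
   Dinur–Harsha–Kindler and the Dinur–Safra reduction): for some `α > 0` the promise problem
   `gapCMMSA (Δ^α) (Δ^{-α}) Δ` is NP-hard under deterministic Karp reductions;
2. `Hirahara2022_gapCMMSA_randReducible_MCSPStar` (this file; Hirahara 2022, Lemma 8.3 and the
   `MCSP*` case of the proof of Thm. 8.5: secret sharing for monotone formulas, Nisan–Wigderson
   designs, the Impagliazzo–Wigderson derandomized XOR lemma as a locally encodable
   list-decodable code, Uhlig's theorem, and Kolmogorov-complexity information extraction):
   for every `α > 0` that promise problem randomly reduces (`PromiseRandReducible`, two-sided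
   error `≤ 1/3`, exactly polynomially many coins) to `MCSP*`;
3. `IsRandNPHard.of_isNPHard_promise` (`PromiseRandReductions.lean`, proved): a Karp reduction
   into the gap problem followed by the randomized reduction is a randomized reduction
   (`RandAlg.precomp`), for every `L ∈ NP`.

`isRandNPHard_MCSPStar_of_CMMSA` assembles 1–3; `isRandNPHard_MCSPStar_holds` is therefore
reduced to discharging the two named facts 1 and 2 (each a theory of its own: PCPs, resp.
pseudorandom generator reconstruction and circuit upper bounds, plus TM2 implementations of
the reductions), tracked in the literature-prover notes for this fact.

## Faithfulness notes

* Hirahara's `MCSP*` instances are `(f, 1^s)` with `s` in unary and `f ∈ {0,1,*}^{2^n}`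
  (Def. 8.4); G14's `MCSPStar` (`MetaComplexity/MCSP.lean`) takes `s` in binary and circuits
  over the full binary basis `B2` with `Circuit.size`. A reduction producing `1^s` yields one
  producing `bin(s)` (an `FP` post-processing), and constant-factor discrepancies between size
  measures of `O(1)`-fan-in circuits are absorbed by the growing gap `(log N)^α` of Thm. 8.5
  ("NP-hard to approximate within a factor of `(log N)^α`"), so fact 2 is stated directly for
  `MCSPStar`.
* Hirahara's reductions have one-sided error (yes ↦ yes with probability `1`, no ↦ no with
  probability `1 - o(1)`); `PromiseRandReducible` asks `2/3` on both sides for *every* instance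
  in the promise, which the printed reduction meets on all but finitely many "sizes" and a
  reduction may meet everywhere by solving instances with boundedly many variables by brute
  force (at most `2^{n₀}` assignments) — the standard convention behind "NP-hard under
  randomized polynomial-time many-one reductions" (Arora–Barak 2009, Def. 7.16).

## References

* S. Hirahara, *NP-hardness of learning programs and partial MCSP*, FOCS 2022, pp. 968–979;
  ECCC TR22-119: Thm. 1.2 (p. 5), Def. 5.1 and Thm. 5.2 (pp. 15–16), Lemma 8.3 (p. 26),
  Def. 8.4 and Thm. 8.5 with its proof (pp. 30–31).
* S. Arora, B. Barak, *Computational Complexity: A Modern Approach*, CUP 2009, Def. 7.16, §7.6.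
-/

namespace Literature.Computability.Complexity

open _root_.Computability MetaComplexity PromiseProblem

/-- **Hirahara 2022, Lemma 8.3 together with the `MCSP*` case of the proof of Thm. 8.5: the
randomized reduction from CMMSA to `MCSP*`.** Lemma 8.3 (printed): there is a randomized
polynomial-time reduction `R` taking a CMMSA instance `(Φ, w, θ)` of size `n` and degree `Δ`
(and a parameter `ε'`) to a distribution `E` (a circuit) and `s ∈ ℕ` such that
(completeness) a weight-`θ` assignment satisfying all of `Φ` yields a circuit of size
`O(s / log s)` (and depth `O(log s)`) computing `b` from `x` for every `(x, b) ∈ supp E`, and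
(soundness) if every weight-`θ` assignment satisfies at most an `ε'`-fraction of `Φ` then with
probability `1 - o(1)` over the coins of `R` no program of size `s/2` predicts `b` from `x`
with probability `> 1/2 + 2ε'` over `E`; moreover `|x| = O(log n + Δ²)` and `supp E` is
enumerable in time `2^{O(|x|)}`. Proof of Thm. 8.5 (`MCSP*` case): at `Δ(n) = (log n)^{1/2}`,
list `supp E` as a partial truth table `f : {0,1}^{O(log n)} → {0,1,*}` and output
`(f, s_P)`, `s_P := O(s / log s)`; yes-instances of CMMSA with gap `Δ^α` and soundness `Δ^{-α}`
go to yes-instances of `MCSP*` (probability `1`), no-instances to no-instances (probability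
`1 - o(1)`; a consistent circuit of size `s'` gives `K(y) ≤ O(s' log s')` against
`K(y) ≥ s · Δ^α`). Vendored as: for every `α > 0`, the promise problem
`gapCMMSA (Δ^α) (Δ^{-α}) Δ`, `Δ = sqrtLog`, reduces to `MCSP*` (`MCSPStar`, as the promise
problem `ofLanguage MCSPStar`) by a randomized polynomial-time many-one reduction with
two-sided error `≤ 1/3` (`PromiseRandReducible`). The ingredients of the printed proof are
Lemma 4.5 (Benaloh–Leichter / Ito–Saito–Nishizeki secret sharing for monotone formulas),
Prop. 6.2 and Lemma 6.6 (Nisan–Wigderson designs and information extraction), Lemma 8.1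
(Impagliazzo–Wigderson 1997 as a locally encodable list-decodable code), Lemma 8.2 (Uhlig's
theorem) and Fact 4.2. [cite: Hirahara2022PartialMCSP, Lemma 8.3 and proof of Thm. 8.5 (MCSP* case), pp. 26–31] -/
def Hirahara2022_gapCMMSA_randReducible_MCSPStar : Prop :=
  ∀ α : ℝ, 0 < α →
    PromiseRandReducible
      (gapCMMSA (fun n => (sqrtLog n : ℝ) ^ α) (fun n => (sqrtLog n : ℝ) ^ (-α)) sqrtLog)
      (ofLanguage MCSPStar)

end Literature.Computability.Complexity

namespace Literature.Computability.Complexity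

open _root_.Computability MetaComplexity

/-- **Assembly of Hirahara's proof of Thm. 8.5 for `MCSP*`.** NP-hardness of CMMSA at
`Δ(n) = (log n)^{1/2}` (Thm. 5.2, fact `Hirahara2022_thm52_sqrtLog`) and the randomized
reduction from that gap problem to `MCSP*` (Lemma 8.3 / proof of Thm. 8.5, fact
`Hirahara2022_gapCMMSA_randReducible_MCSPStar`) give `IsRandNPHard MCSPStar`, by composing, for
each `L ∈ NP`, the Karp reduction into CMMSA with the randomized reduction
(`IsRandNPHard.of_isNPHard_promise`, proved in `PromiseRandReductions.lean`).
[cite: Hirahara2022PartialMCSP, proof of Thm. 8.5, p. 30] -/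
theorem isRandNPHard_MCSPStar_of_CMMSA (h52 : Hirahara2022_thm52_sqrtLog)
    (h83 : Hirahara2022_gapCMMSA_randReducible_MCSPStar) : isRandNPHard_MCSPStar := by
  obtain ⟨α, hα, hhard⟩ := h52
  exact IsRandNPHard.of_isNPHard_promise hhard (h83 α hα)

/-- With `MCSP* ∈ NP` (G14's fact `MCSPStar_mem_NP`), the same two facts give the randomized
NP-completeness of `MCSP*`, `IsRandComplete NP MCSPStar` (`MCSP* ∈ NP ∧ IsRandHard NP MCSP*`;
stated directly in this vocabulary — the completeness statement is not a separate named fact,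
being equivalent to `isRandNPHard_MCSPStar` once `MCSP* ∈ NP` is proved, see
`isRandComplete_NP_MCSPStar_iff` in `MCSPHardnessFromPCP.lean`). [cite: Hirahara2022PartialMCSP, Thm. 8.5 and §1.2 ("MCSP ∈ NP")] -/
theorem isRandComplete_NP_MCSPStar_of_CMMSA (hNP : MCSPStar_mem_NP)
    (h52 : Hirahara2022_thm52_sqrtLog) (h83 : Hirahara2022_gapCMMSA_randReducible_MCSPStar) :
    IsRandComplete Nondeterministic.NP MCSPStar :=
  ⟨hNP, isRandNPHard_MCSPStar_of_CMMSA h52 h83⟩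

end Literature.Computability.Complexity
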